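import Summits.QuantumFields.YangMills.Theorems.BalabanUVNodesPortHRecordRowGBase

/-!
# PORT PT-H, record side (helper; O-3 (a)) — THE SLOT-8 «RowG» ROW AT THE RECORD NAMES, part 2: ★ `GeomLeaf (recordSiteGeom …) (recordRho …) Mg 2` (every `Mg ≥ 4·Mc`),
# ★ `CubeSumLeaf (recordSiteGeom …) a ((2(1 − e^{−a·Mc}))⁻¹)⁴`, the tree leaves, the window row, and ★★ `rowG_slot8_at_names` — the fifth antecedent of the slot-8 text
# `PortPiDecayUniformH` (stmt-QuantumFields-27266, CLOSED) AT THE RECORD, every member, no residual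

Cell `ym-nodeO-ideate` ∕ `ym-balaban-port`, porter seat `ymgap-nodeO-port-PTC-1` (gen 2; ORDER O-3 (a), `--supports stmt-QuantumFields-27238 --as helper`).  **Statements and proofs
LANDED VERBATIM (sections §7 (W∕tree leaves), §9, §10, §11, §12 of the HOME line file `nodeO-cover/LENS-1-Obligation1-GroupG-v1.3.lean` 4b94d93a503c9308) from the planner seat
`ymgap-nodeO-lens-1` (g3∕g4); credit theirs; re-homed under a Theorems namespace for the slot-8 JOIN.**  [I] = [Balaban1987RG1].

WHAT IS HERE: §7 `rowW_at` (the window identification `ρ(e μ 0, e ν z) = |z|₁` on the window), `rowTreeLeaves_at`, `rowW_treeLeaves_at`; §9 `sitesPerDir_eq_domCount_mul`,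
`idxDist_eq_sum_natAbs`, `exists_site_in_cube`, `tdist_le_mul_idxDist_add`, ★ `rowGeomLeaf_at`; §10 `sum_exp_valMinAbs_le`, ★ `rowCubeSumLeaf_at`, `rowCubeSumLeaf_at'`; §11 `geomLeaves_at`;
§12 `domCount_base_add`, `two_pow_le_recordRNat`, `eventually_window`, ★★ `rowG_slot8_at_names`, `rowG_slot8_at_fromJ ∕ _fromCtr ∕ _from`.
HONEST FRAMING.  Elementary geometry at the names; nothing of Bałaban asserted, ported or discharged; finite `𝕋⁴_{L^K}` at fixed ε — NOT continuum ∕ OS ∕ Clay; **the Yang–Mills mass gap is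
NOT proved.**  No `def`, `instance`, `sorry`; standard axioms.
-/

noncomputable section

open scoped BigOperators

namespace Summit.QuantumFields.YangMills.Theorems.PortHRecordRowG

open Literature.MathematicalPhysics.QuantumFieldTheory.Balaban1983to89
open Literature.MathematicalPhysics.QuantumFieldTheory.Balaban1983to89.Node00
open Literature.MathematicalPhysics.QuantumFieldTheory.Balaban1983to89.T4Continuum (T4Family)
open Literature.MathematicalPhysics.QuantumFieldTheory.Balaban1983to89.TreeLengthTorus (TPt TAdj TStepIn TLinked TFaceConnected IsTDom TAdmissible
  torusTreeLen le_torusTreeLen exists_tAdmissible proj proj_apply)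
open Literature.MathematicalPhysics.QuantumFieldTheory.Balaban1983to89.TreeLength (RPt Seg carrier len lenIn cube mem_cube len_nonneg
  sum_lenIn_le_len le_lenIn_closedBall)
open Summit.QuantumFields.YangMills.Theorems.K0RecordFormatNames

variable (F : T4Family)

/-! ## §7  (v1.1) ★ ROW (W) at the RADIUS slot and the two TREE LEAVES at the names — selection-free rows, NO residual -/

variable {F} in
/-- **ROW (W) = shape clause «`ρ n (e n μ 0) (e n ν z) = ‖z‖₁` for `2|z_i| < N k n`» AT THE NAMES WITH THE RADIUS SLOT `N := recordRNat`**: on the tiled range the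
radius never exceeds the period (`recordRNat ≤ Mc·q = recordN`, DEF-1 `recordRNat_le` + `recordN_eq_domCount_mul`), so DEF-1's whole-torus window identity
`recordRho_recordE_window` applies verbatim. [cite: Balaban1987RG1, (1.21) p.264 (bookkeeping)] -/
theorem rowW_at {Mc k K : ℕ} (hMc : McGuard F Mc) (hK : recordK₀ F Mc k ≤ K) (μ ν : Fin 4) (z : Fin 4 → ℤ)
    (hz : ∀ i, 2 * |z i| < (recordRNat F Mc k K : ℤ)) :
    recordRho F k K (recordE F k K μ 0) (recordE F k K ν z) = B12Sec2to5.l1 z := by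
  refine recordRho_recordE_window F k K μ ν z fun i => lt_of_lt_of_le (hz i) ?_
  have h1 : recordRNat F Mc k K ≤ recordN F k K := by
    rw [recordN_eq_domCount_mul hMc hK, Nat.mul_comm]
    exact recordRNat_le F Mc k K
  exact_mod_cast h1

/-- **ROWS (LeavesT) = shape clauses `TreeLeaf (Cc n) (κ∕2) K₀` and `TreeLeaf (Cc n) (κ∕2∕2) K₀'` AT THE NAMES**, both with the tree's constant
`K₀ = K₀' := B12TreeDecay.K₀ (4·2⁴) (2·4)`, for every `κ ≥ 4·κ₀(64, 8)` (the LINE's `RowLeavesT` threshold): DEF-1's `treeLeaf_recordCc` = the tree's `hTree_torus`,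
twice. [cite: Balaban1987RG1, (0.26) p.257–258; Balaban1985UV2, (1.26)] -/
theorem rowTreeLeaves_at {κ : ℝ} (hκ : 4 * B12TreeDecay.kappa₀ (4 * 2 ^ 4) (2 * 4) ≤ κ) (Mc k K : ℕ) :
    B12Decay510.TreeLeaf (recordCc F Mc k K) (κ / 2) (B12TreeDecay.K₀ (4 * 2 ^ 4) (2 * 4)) ∧
    B12Decay510.TreeLeaf (recordCc F Mc k K) (κ / 2 / 2) (B12TreeDecay.K₀ (4 * 2 ^ 4) (2 * 4)) := by
  have h0 : 0 ≤ B12TreeDecay.kappa₀ (4 * 2 ^ 4) (2 * 4) := B12TreeDecay.kappa₀_nonneg (by norm_num) _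
  -- (multiply out first: `cancel_denoms` inside `linarith` would `norm_num` the numerals INSIDE the atom `kappa₀ (4·2⁴) (2·4)` of one hypothesis only)
  have h2 : B12TreeDecay.kappa₀ (4 * 2 ^ 4) (2 * 4) ≤ κ / 2 := by
    rw [le_div_iff₀ (by norm_num : (0 : ℝ) < 2)]; linarith
  have h4 : B12TreeDecay.kappa₀ (4 * 2 ^ 4) (2 * 4) ≤ κ / 2 / 2 := by
    rw [le_div_iff₀ (by norm_num : (0 : ℝ) < 2), le_div_iff₀ (by norm_num : (0 : ℝ) < 2)]; linarith
  exact ⟨treeLeaf_recordCc F h2 Mc k K, treeLeaf_recordCc F h4 Mc k K⟩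

variable {F} in
/-- **§7 TOGETHER at the LINE's record data** (`N k n := recordRNat F Mc k (recordK₀ F Mc k + n)`, `ρ n := recordRho F k (recordK₀ … + n)`, `e n := recordE F k (recordK₀ … + n)`,
`Cc n := recordCc F Mc k (recordK₀ … + n)`): clause (W) and the two tree-leaf clauses of `N3PairShapeAtD`, every volume `n` of the shifted range, every admissible letter,
every `κ ≥ 4·κ₀(64, 8)` — no residual. [cite: Balaban1987RG1, (1.21) p.264, (0.26) p.257] -/
theorem rowW_treeLeaves_at {Mc k : ℕ} (hMc : McGuard F Mc) {κ : ℝ} (hκ : 4 * B12TreeDecay.kappa₀ (4 * 2 ^ 4) (2 * 4) ≤ κ) (n : ℕ) :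
    (∀ μ ν : Fin 4, ∀ z : Fin 4 → ℤ, (∀ i, 2 * |z i| < (recordRNat F Mc k (recordK₀ F Mc k + n) : ℤ)) →
      recordRho F k (recordK₀ F Mc k + n) (recordE F k (recordK₀ F Mc k + n) μ 0) (recordE F k (recordK₀ F Mc k + n) ν z) = B12Sec2to5.l1 z) ∧
    B12Decay510.TreeLeaf (recordCc F Mc k (recordK₀ F Mc k + n)) (κ / 2) (B12TreeDecay.K₀ (4 * 2 ^ 4) (2 * 4)) ∧
    B12Decay510.TreeLeaf (recordCc F Mc k (recordK₀ F Mc k + n)) (κ / 2 / 2) (B12TreeDecay.K₀ (4 * 2 ^ 4) (2 * 4)) :=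
  ⟨fun μ ν z hz => rowW_at hMc (Nat.le_add_right _ _) μ ν z hz, rowTreeLeaves_at F hκ Mc k _⟩


open Literature.MathematicalPhysics.QuantumFieldTheory.Balaban1983to89.B3Taylor310LocalRemainder (tdist_eq_sum_natAbs tdist_comm tdist_triangle)

/-! ## §9  (v1.2) At the names: reaching a prescribed cube, site-vs-index diameter, ★ ROW (GeomLeaf) — NO residual -/

variable {F} in
/-- `N = q · Mc` for the unit torus `T^{(k+1)}` of `T_K` on the tiled range (DEF-1 `recordN_eq_domCount_mul`, re-keyed to `sitesPerDir`). [cite: Balaban1987RG1, p.257 (bookkeeping)] -/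
theorem sitesPerDir_eq_domCount_mul {Mc k K : ℕ} (hMc : McGuard F Mc) (hK : recordK₀ F Mc k ≤ K) :
    (F.P K).sitesPerDir (k + 1) = Sect2.domCount (F.P K) Mc (k + 1) * Mc := by
  rw [← recordN_eq F k K]; exact recordN_eq_domCount_mul hMc hK

/-- `idxDist` as a sum of `|valMinAbs|`. [folklore] -/
theorem idxDist_eq_sum_natAbs {d q : ℕ} [NeZero q] (a b : TPt d q) : idxDist a b = ∑ i, (a i - b i).valMinAbs.natAbs :=
  Finset.sum_congr rfl fun i _ => min_val_sub (a i) (b i)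

variable {F} in
/-- **Reaching a prescribed cube of `𝐃_{k+1}(T_K)`**: from any unit-lattice site `y` there is a site `p` IN the cube `c` with `|y − p|₁ ≤ Mc · idxDist(□(y), c)`.
[cite: Balaban1987RG1, p.257 (bookkeeping)] -/
theorem exists_site_in_cube {Mc k K : ℕ} (hMc : McGuard F Mc) (hK : recordK₀ F Mc k ≤ K) (y : Site (F.P K) (k + 1))
    (c : TPt (F.P K).d (Sect2.domCount (F.P K) Mc (k + 1))) :
    ∃ p : Site (F.P K) (k + 1), cubeIdxOf F Mc k K p = c ∧ Site.tdist y p ≤ Mc * idxDist (cubeIdxOf F Mc k K y) c := by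
  have hN := sitesPerDir_eq_domCount_mul hMc hK
  have h0 := mc_pos hMc
  choose w hw using fun i => exists_val_div_eq_and_dist_le (q := Sect2.domCount (F.P K) Mc (k + 1)) h0 hN (y i) (c i)
  refine ⟨fun i => w i, funext fun i => (hw i).1, ?_⟩
  rw [tdist_eq_sum_natAbs, idxDist_eq_sum_natAbs, Finset.mul_sum]
  exact Finset.sum_le_sum fun i _ => (hw i).2

variable {F} in
/-- **Site diameter versus cube-index diameter**: `|p − p'|₁ + d ≤ Mc · idxDist(□(p), □(p')) + d·Mc`. [cite: Balaban1987RG1, p.257 (bookkeeping)] -/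
theorem tdist_le_mul_idxDist_add {Mc k K : ℕ} (hMc : McGuard F Mc) (hK : recordK₀ F Mc k ≤ K) (p p' : Site (F.P K) (k + 1)) :
    Site.tdist p p' + (F.P K).d ≤ Mc * idxDist (cubeIdxOf F Mc k K p) (cubeIdxOf F Mc k K p') + (F.P K).d * Mc := by
  have hN := sitesPerDir_eq_domCount_mul hMc hK
  have h0 := mc_pos hMc
  have h := fun i => dist_le_mul_idx_add (q := Sect2.domCount (F.P K) Mc (k + 1)) h0 hN (p i) (p' i)
  rw [tdist_eq_sum_natAbs, idxDist_eq_sum_natAbs, Finset.mul_sum]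
  have hs := Finset.sum_le_sum fun i (_ : i ∈ (Finset.univ : Finset (Fin (F.P K).d))) => h i
  rw [Finset.sum_add_distrib, Finset.sum_add_distrib] at hs
  simp only [Finset.sum_const, Finset.card_univ, Fintype.card_fin, smul_eq_mul, mul_one] at hs
  exact hs

variable {F} in
/-- **★ ROW (GeomLeaf) = shape clause `GeomLeaf (G n) (ρ n) M c₁` AT THE NAMES, PROVED with `c₁ = 2`, every `M ≥ 4·Mc`** (no residual): the tree's two-field reduction
`B12Decay510.geomLeaf_of_diam` with «`p ∈ X`» := «the cube of the site of `p` is a cube of `X`», fed by ROW (Diam) (`cubeDiam_at`, §2), the site-vs-index diameter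
(`tdist_le_mul_idxDist_add`) and the reaching lemma (`exists_site_in_cube`: the nearest cube `recordPick` of `X` contains a site within `distD(x, X)` of `x`).
[cite: Balaban1987RG1, §0 p.257 (localization domains, d_j), (5.10) p.293] -/
theorem rowGeomLeaf_at {Mc k K : ℕ} (hMc : McGuard F Mc) (hK : recordK₀ F Mc k ≤ K) {M : ℝ} (hM : 4 * (Mc : ℝ) ≤ M) :
    B12Decay510.GeomLeaf (recordSiteGeom F Mc k K) (recordRho F k K) M 2 := by
  refine B12Decay510.geomLeaf_of_diam (recordSiteGeom F Mc k K) (fun l X => cubeIdxOf F Mc k K l.2 ∈ (X.1 : Finset _))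
    (fun a b => by unfold recordRho; rw [tdist_comm]) (fun a b c => by unfold recordRho; exact_mod_cast tdist_triangle a.2 b.2 c.2) ?_ ?_
  · intro X l l' hl hl'
    have h1 : Site.tdist l.2 l'.2 + 4 ≤ Mc * idxDist (cubeIdxOf F Mc k K l.2) (cubeIdxOf F Mc k K l'.2) + 4 * Mc :=
      tdist_le_mul_idxDist_add hMc hK l.2 l'.2
    have h1' : (Site.tdist l.2 l'.2 : ℝ) + 4 ≤ (Mc : ℝ) * (idxDist (cubeIdxOf F Mc k K l.2) (cubeIdxOf F Mc k K l'.2) : ℝ) + 4 * Mc := by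
      exact_mod_cast h1
    have h2 := cubeDiam_at F Mc k K X hl hl'
    have hdj : 0 ≤ (recordDomSys F Mc k K).dj X := (recordDomSys F Mc k K).dj_nonneg X
    have h3 : 4 * (Mc : ℝ) * (recordDomSys F Mc k K).dj X ≤ M * (recordDomSys F Mc k K).dj X := mul_le_mul_of_nonneg_right hM hdj
    unfold recordRho
    linarith
  · intro l X
    obtain ⟨p, hp, hd⟩ := exists_site_in_cube hMc hK l.2 (recordPick F Mc k K l X)
    refine ⟨(l.1, p), ?_, ?_⟩
    · show cubeIdxOf F Mc k K p ∈ (X.1 : Finset _)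
      rw [hp]; exact (recordPick_spec F Mc k K l X).1
    · show (Site.tdist l.2 p : ℝ) ≤ recordDistC F Mc k K l (recordPick F Mc k K l X)
      unfold recordDistC
      exact_mod_cast hd


/-! ## §10  (v1.2) ★ ROWS (CubeSumLeaf) at the names: `Σ_□ exp(−a·dist(x, □)) ≤ (2(1 − e^{−a·Mc})⁻¹)⁴ ≤ (2(1 − e^{−a})⁻¹)⁴`, every `a > 0` — NO residual -/

/-- One index-torus coordinate: `Σ_{x ∈ ℤ∕q} e^{−b|(u − x)~|} ≤ 2(1 − e^{−b})⁻¹`, uniformly in `q` (injectivity of `valMinAbs` + the 1-D lattice sum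
`B4Sect5Proof.sum_exp_neg_abs_le`). [folklore] -/
theorem sum_exp_valMinAbs_le {q : ℕ} [NeZero q] (u : ZMod q) {b : ℝ} (hb : 0 < b) :
    ∑ x : ZMod q, Real.exp (-b * ((u - x).valMinAbs.natAbs : ℝ)) ≤ 2 * (1 - Real.exp (-b))⁻¹ := by
  classical
  have hinj : ∀ x ∈ (Finset.univ : Finset (ZMod q)), ∀ y ∈ (Finset.univ : Finset (ZMod q)),
      (u - x).valMinAbs = (u - y).valMinAbs → x = y :=
    fun x _ y _ h => sub_right_injective (ZMod.injective_valMinAbs h)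
  have step1 : ∑ x : ZMod q, Real.exp (-b * ((u - x).valMinAbs.natAbs : ℝ)) =
      ∑ x : ZMod q, Real.exp (-(b * |((0 : ℤ) : ℝ) - ((u - x).valMinAbs : ℝ)|)) := by
    refine Finset.sum_congr rfl fun x _ => ?_
    rw [Nat.cast_natAbs, Int.cast_abs, Int.cast_zero, zero_sub, abs_neg, neg_mul]
  have step2 := (Finset.sum_image (f := fun m : ℤ => Real.exp (-(b * |((0 : ℤ) : ℝ) - (m : ℝ)|)))
    (g := fun x : ZMod q => (u - x).valMinAbs) hinj).symm
  rw [step1, step2]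
  exact B4Sect5Proof.sum_exp_neg_abs_le _ 0 hb

variable {F} in
/-- **★ ROW (CubeSumLeaf) AT THE NAMES, PROVED**: `Σ_{□ ∈ π_{k+1}} exp(−a · dist(x, □)) ≤ (2(1 − e^{−a·Mc})⁻¹)^4` for every label `x`, every `a > 0` — the sum
factorises over the four index-torus coordinates. [cite: Balaban1987RG1, (5.10) p.293 («yields»), p.257] -/
theorem rowCubeSumLeaf_at {Mc : ℕ} (hMc : McGuard F Mc) (k K : ℕ) {a : ℝ} (ha : 0 < a) :
    B12Decay510.CubeSumLeaf (recordSiteGeom F Mc k K) a ((2 * (1 - Real.exp (-(a * Mc)))⁻¹) ^ 4) := by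
  classical
  intro l
  have h0 : (0 : ℝ) < Mc := by exact_mod_cast mc_pos hMc
  have hb : 0 < a * Mc := mul_pos ha h0
  set u := cubeIdxOf F Mc k K l.2 with hu
  show ∑ c : TPt (F.P K).d (Sect2.domCount (F.P K) Mc (k + 1)), Real.exp (-a * recordDistC F Mc k K l c) ≤ _
  have hterm : ∀ c : TPt (F.P K).d (Sect2.domCount (F.P K) Mc (k + 1)),
      Real.exp (-a * recordDistC F Mc k K l c) = ∏ i, Real.exp (-(a * Mc) * ((u i - c i).valMinAbs.natAbs : ℝ)) := by
    intro c
    rw [← Real.exp_sum]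
    congr 1
    unfold recordDistC
    rw [← hu, idxDist_eq_sum_natAbs, Nat.cast_sum, Finset.mul_sum, Finset.mul_sum]
    refine Finset.sum_congr rfl fun i _ => ?_
    ring
  have heq := Fintype.prod_sum fun (i : Fin (F.P K).d) (y : ZMod (Sect2.domCount (F.P K) Mc (k + 1))) =>
    Real.exp (-(a * Mc) * ((u i - y).valMinAbs.natAbs : ℝ))
  rw [Finset.sum_congr rfl fun c _ => hterm c, ← heq]
  calc ∏ i : Fin (F.P K).d, ∑ x : ZMod (Sect2.domCount (F.P K) Mc (k + 1)), Real.exp (-(a * Mc) * ((u i - x).valMinAbs.natAbs : ℝ))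
      ≤ ∏ _i : Fin (F.P K).d, 2 * (1 - Real.exp (-(a * Mc)))⁻¹ :=
        Finset.prod_le_prod (fun i _ => Finset.sum_nonneg fun x _ => (Real.exp_pos _).le) fun i _ => sum_exp_valMinAbs_le (u i) hb
    _ = (2 * (1 - Real.exp (-(a * Mc)))⁻¹) ^ 4 := by rw [Finset.prod_const, Finset.card_univ, Fintype.card_fin]; rfl

variable {F} in
/-- **… with an `Mc`-free constant** (`Mc ≥ 1`): `Σ_□ exp(−a·dist(x, □)) ≤ (2(1 − e^{−a})⁻¹)^4 = B4Sect5Proof's 1-D constant to the fourth`. [cite: Balaban1987RG1, (5.10) p.293 («yields»)] -/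
theorem rowCubeSumLeaf_at' {Mc : ℕ} (hMc : McGuard F Mc) (k K : ℕ) {a : ℝ} (ha : 0 < a) :
    B12Decay510.CubeSumLeaf (recordSiteGeom F Mc k K) a ((2 * (1 - Real.exp (-a))⁻¹) ^ 4) := by
  intro l
  refine (rowCubeSumLeaf_at hMc k K ha l).trans ?_
  have h1 : (1 : ℝ) ≤ Mc := by exact_mod_cast mc_pos hMc
  have he : Real.exp (-(a * Mc)) ≤ Real.exp (-a) := Real.exp_le_exp.2 (by nlinarith)
  have hlt : Real.exp (-a) < 1 := Real.exp_lt_one_iff.2 (by linarith)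
  have hpos : 0 < 1 - Real.exp (-a) := by linarith
  have hpos' : 0 < 1 - Real.exp (-(a * Mc)) := by linarith
  have hinv : (1 - Real.exp (-(a * Mc)))⁻¹ ≤ (1 - Real.exp (-a))⁻¹ := by
    rw [inv_le_inv₀ hpos' hpos]; linarith
  have h2 : (0 : ℝ) ≤ 2 * (1 - Real.exp (-(a * Mc)))⁻¹ := by positivity
  exact pow_le_pow_left₀ h2 (by linarith) 4



/-! ## §11  (v1.2) ★ The GEOMETRIC LEAVES of `N3PairShapeAtD` TOGETHER at the LINE's record data, every volume of the shifted range — NO residual -/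

variable {F} in
/-- **THE THREE LEAF ROWS `GeomLeaf (G n) (ρ n) M c₁ ∧ CubeSumLeaf (G n) (δ₀∕2) K₁ ∧ CubeSumLeaf (G n) (δ₀∕2∕2) K₁'` of `N3PairShapeAtD`, DISCHARGED** at
`G n := recordSiteGeom F Mc k (recordK₀ F Mc k + n)`, `ρ n := recordRho F k (recordK₀ F Mc k + n)`, with `c₁ := 2`, `K₁ := (2(1 − e^{−δ₀∕2})⁻¹)⁴`, `K₁' := (2(1 − e^{−δ₀∕4})⁻¹)⁴`
(uniform in `n`, `k`, `Mc`), for every `n`, every admissible letter `Mc`, every `M ≥ 4·Mc`, every `δ₀ > 0`.  Together with §6 (`groupG_at`: (inj)∕(G1)∕(G2)) and §7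
(`rowW_treeLeaves_at`: (W) + the two `TreeLeaf` rows) EVERY functional-free row of the shape now holds at the names; the rows left are exactly the five carrying Bałaban's
functionals (`RowE118D`, the gauge decay of `h`, locality of `E_X` under `emb ∕ T`, the gauge tails at window bonds, the representation `Pk = Σ_X Re ∂²E_X`).
[cite: Balaban1987RG1, §0 p.257, (5.10) p.293] -/
theorem geomLeaves_at {Mc k : ℕ} (hMc : McGuard F Mc) {M : ℝ} (hM : 4 * (Mc : ℝ) ≤ M) {δ₀ : ℝ} (hδ₀ : 0 < δ₀) (n : ℕ) :
    B12Decay510.GeomLeaf (recordSiteGeom F Mc k (recordK₀ F Mc k + n)) (recordRho F k (recordK₀ F Mc k + n)) M 2 ∧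
    B12Decay510.CubeSumLeaf (recordSiteGeom F Mc k (recordK₀ F Mc k + n)) (δ₀ / 2) ((2 * (1 - Real.exp (-(δ₀ / 2)))⁻¹) ^ 4) ∧
    B12Decay510.CubeSumLeaf (recordSiteGeom F Mc k (recordK₀ F Mc k + n)) (δ₀ / 2 / 2) ((2 * (1 - Real.exp (-(δ₀ / 2 / 2)))⁻¹) ^ 4) :=
  ⟨rowGeomLeaf_at hMc (Nat.le_add_right _ _) hM, rowCubeSumLeaf_at' hMc k _ (half_pos hδ₀), rowCubeSumLeaf_at' hMc k _ (half_pos (half_pos hδ₀))⟩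


/-! ## §12  ★ (v1.3, lens-1 g4) THE SLOT-8 TEXT's «RowG» ROW AT THE RECORD — every member `n`, all three `Response9Data` editions — PROVED, no residual
T-3′ `PortPiDecayUniformH` (typer-1 g2; HOME `nodeO-cover/TYPER-SigT3p-v1.txt` 9e27aaca2379dab6; the record-facing slot-8 text per CRIT-1's Q-8 ruling, HOME STATUS l.3970)
carries as its fifth antecedent, for the response data `R`, the row
`(∀ n, GeomLeaf (R.G n) (R.ρ n) Mg c₁ ∧ CubeSumLeaf (R.G n) (δ₀ ∕ 2) K₁ ∧ TreeLeaf (R.Cc n) (κ ∕ 2) K₀) ∧ ∀ μ ν z, ∀ᶠ n in atTop, R.ρ n (R.e n μ 0) (R.e n ν z) = l1 z`.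
At the record (`G n = recordSiteGeom F Mc k (K₀+n)`, `ρ n = recordRho F k (K₀+n)`, `e n = recordE F k (K₀+n)`, `Cc n = recordCc F Mc k (K₀+n)`, `K₀ = recordK₀ F Mc k`; the same
four fields in `recordResponse9DataFrom ∕ FromCtr ∕ FromJ`) it HOLDS OUTRIGHT with `c₁ := 2`, every `Mg ≥ 4·Mc`, `K₁ := (2(1 − e^{−δ₀∕2}))⁻¹)⁴`, `K₀ := B12TreeDecay.K₀ 64 8` and every
`κ ≥ 2·kappa₀(64, 8)`; the window identification is EVENTUAL in `n` because `recordRNat F Mc k (K₀ + n) ≥ 2ⁿ`.  (The letters `Mg, K₁, K₀, c₁, κ, δ₀` of T-3′ are chosen BEFORE its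
`∃ C`; `K₁, K₀, c₁` here are absolute, `Mg` needs only the join's bound on `Mc`, e.g. `Mc ≤ L^j`.)  [cite: Balaban1987RG1, p.257 (cubes tile the torus), (1.21) p.264 (bookkeeping)] -/

variable {F} in
/-- `q_{K₀+n} = Lⁿ · q_{K₀}` along the members (iterate `domCount_succ_eq`). [cite: Balaban1987RG1, p.257] -/
theorem domCount_base_add {Mc : ℕ} (hMc : McGuard F Mc) (k n : ℕ) :
    Sect2.domCount (F.P (recordK₀ F Mc k + n)) Mc (k + 1) = F.L ^ n * Sect2.domCount (F.P (recordK₀ F Mc k)) Mc (k + 1) := by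
  induction n with
  | zero => simp
  | succ n ih =>
    show Sect2.domCount (F.P (recordK₀ F Mc k + n + 1)) Mc (k + 1) = _
    rw [PortU8.domCount_succ_vol hMc (Nat.le_add_right _ _), ih, pow_succ]; ring

variable {F} in
/-- **The window radius at least doubles along the members**: `2ⁿ ≤ recordRNat F Mc k (K₀ + n)`. [cite: Balaban1987RG1, (1.21) p.264 (bookkeeping)] -/
theorem two_pow_le_recordRNat {Mc : ℕ} (hMc : McGuard F Mc) (k n : ℕ) : 2 ^ n ≤ recordRNat F Mc k (recordK₀ F Mc k + n) := by
  have hq : F.L ≤ Sect2.domCount (F.P (recordK₀ F Mc k)) Mc (k + 1) / 2 := le_domCount_div_two hMc le_rfl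
  have hL : 2 ≤ F.L := F.hL.2
  unfold recordRNat
  rw [domCount_base_add hMc k n]
  calc 2 ^ n ≤ F.L ^ n := Nat.pow_le_pow_left hL n
    _ ≤ F.L ^ n * (Sect2.domCount (F.P (recordK₀ F Mc k)) Mc (k + 1) / 2) := Nat.le_mul_of_pos_right _ (by omega)
    _ ≤ F.L ^ n * Sect2.domCount (F.P (recordK₀ F Mc k)) Mc (k + 1) / 2 := Nat.mul_div_le_mul_div_assoc _ _ _
    _ ≤ Mc * (F.L ^ n * Sect2.domCount (F.P (recordK₀ F Mc k)) Mc (k + 1) / 2) := Nat.le_mul_of_pos_left _ (mc_pos hMc)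

variable {F} in
/-- Every lattice vector `z` is EVENTUALLY strictly inside the half-window: `∀ᶠ n, ∀ i, 2|z_i| < recordRNat F Mc k (K₀ + n)`. [cite: Balaban1987RG1, (1.21) p.264] -/
theorem eventually_window {Mc : ℕ} (hMc : McGuard F Mc) (k : ℕ) (z : Fin 4 → ℤ) :
    ∀ᶠ n in Filter.atTop, ∀ i, 2 * |z i| < (recordRNat F Mc k (recordK₀ F Mc k + n) : ℤ) := by
  refine Filter.eventually_atTop.2 ⟨2 * (∑ j, (z j).natAbs) + 1, fun n hn i => ?_⟩
  have h1 : (z i).natAbs ≤ ∑ j, (z j).natAbs :=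
    Finset.single_le_sum (f := fun j => (z j).natAbs) (fun _ _ => Nat.zero_le _) (Finset.mem_univ i)
  have h2 : n < 2 ^ n := Nat.lt_two_pow_self
  have h3 := two_pow_le_recordRNat hMc k n
  have key : 2 * (z i).natAbs < recordRNat F Mc k (recordK₀ F Mc k + n) := by omega
  rw [← Int.natCast_natAbs]
  exact_mod_cast key

variable {F} in
/-- ★ **The slot-8 text's «RowG» row AT THE RECORD NAMES, every member** — `GeomLeaf` (c₁ = 2, any `Mg ≥ 4·Mc`), `CubeSumLeaf` at rate `δ₀∕2`, `TreeLeaf` at rate `κ∕2`,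
and the EVENTUAL window identification — no residual, no hypothesis about Bałaban's functionals. [cite: Balaban1987RG1, (0.26) p.258, (1.21) p.264, (4.37) p.290, p.257] -/
theorem rowG_slot8_at_names {Mc k : ℕ} (hMc : McGuard F Mc) {Mg : ℝ} (hMg : 4 * (Mc : ℝ) ≤ Mg) {κ : ℝ}
    (hκ : 2 * B12TreeDecay.kappa₀ (4 * 2 ^ 4) (2 * 4) ≤ κ) {δ₀ : ℝ} (hδ₀ : 0 < δ₀) :
    (∀ n, B12Decay510.GeomLeaf (recordSiteGeom F Mc k (recordK₀ F Mc k + n)) (recordRho F k (recordK₀ F Mc k + n)) Mg 2 ∧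
        B12Decay510.CubeSumLeaf (recordSiteGeom F Mc k (recordK₀ F Mc k + n)) (δ₀ / 2) ((2 * (1 - Real.exp (-(δ₀ / 2)))⁻¹) ^ 4) ∧
        B12Decay510.TreeLeaf (recordCc F Mc k (recordK₀ F Mc k + n)) (κ / 2) (B12TreeDecay.K₀ (4 * 2 ^ 4) (2 * 4))) ∧
    ∀ (μ ν : Fin 4) (z : Fin 4 → ℤ), ∀ᶠ n in Filter.atTop,
      recordRho F k (recordK₀ F Mc k + n) (recordE F k (recordK₀ F Mc k + n) μ 0) (recordE F k (recordK₀ F Mc k + n) ν z) = B12Sec2to5.l1 z := by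
  have hκ2 : B12TreeDecay.kappa₀ (4 * 2 ^ 4) (2 * 4) ≤ κ / 2 := by
    rw [le_div_iff₀ (by norm_num : (0 : ℝ) < 2)]; linarith
  exact ⟨fun n => ⟨rowGeomLeaf_at hMc (Nat.le_add_right _ _) hMg, rowCubeSumLeaf_at' hMc k _ (half_pos hδ₀), treeLeaf_recordCc F hκ2 Mc k _⟩,
    fun μ ν z => (eventually_window hMc k z).mono fun n hn => rowW_at hMc (Nat.le_add_right _ _) μ ν z hn⟩

variable {F} in
/-- ★ The same row READ THROUGH `recordResponse9DataFromJ F θ a Mc k (recordK₀ F Mc k)` — the edition the rendered ⁷′ `PortPieceLocalityU8` (Theses rev 30 :977) instantiates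
(`θ := thetaFill F a₀ ε₂₉`); the fields `G ∕ ρ ∕ e ∕ Cc` reduce to the record names by `rfl`. [cite: Balaban1987RG1, (1.21) p.264, (4.37) p.290] -/
theorem rowG_slot8_at_fromJ (θ : Stage13Params F 2) (a : θ.ιβ) {Mc k : ℕ} (hMc : McGuard F Mc) {Mg : ℝ} (hMg : 4 * (Mc : ℝ) ≤ Mg) {κ : ℝ}
    (hκ : 2 * B12TreeDecay.kappa₀ (4 * 2 ^ 4) (2 * 4) ≤ κ) {δ₀ : ℝ} (hδ₀ : 0 < δ₀) :
    (∀ n, B12Decay510.GeomLeaf ((recordResponse9DataFromJ F θ a Mc k (recordK₀ F Mc k)).G n) ((recordResponse9DataFromJ F θ a Mc k (recordK₀ F Mc k)).ρ n) Mg 2 ∧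
        B12Decay510.CubeSumLeaf ((recordResponse9DataFromJ F θ a Mc k (recordK₀ F Mc k)).G n) (δ₀ / 2) ((2 * (1 - Real.exp (-(δ₀ / 2)))⁻¹) ^ 4) ∧
        B12Decay510.TreeLeaf ((recordResponse9DataFromJ F θ a Mc k (recordK₀ F Mc k)).Cc n) (κ / 2) (B12TreeDecay.K₀ (4 * 2 ^ 4) (2 * 4))) ∧
    ∀ (μ ν : Fin 4) (z : Fin 4 → ℤ), ∀ᶠ n in Filter.atTop,
      (recordResponse9DataFromJ F θ a Mc k (recordK₀ F Mc k)).ρ n ((recordResponse9DataFromJ F θ a Mc k (recordK₀ F Mc k)).e n μ 0)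
        ((recordResponse9DataFromJ F θ a Mc k (recordK₀ F Mc k)).e n ν z) = B12Sec2to5.l1 z :=
  rowG_slot8_at_names hMc hMg hκ hδ₀

variable {F} in
/-- ★ The same row read through the CENTRED edition `recordResponse9DataFromCtr F θ a Mc k (recordK₀ F Mc k)`. [cite: Balaban1987RG1, (1.21) p.264, (4.37) p.290] -/
theorem rowG_slot8_at_fromCtr (θ : Stage13Params F 2) (a : θ.ιβ) {Mc k : ℕ} (hMc : McGuard F Mc) {Mg : ℝ} (hMg : 4 * (Mc : ℝ) ≤ Mg) {κ : ℝ}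
    (hκ : 2 * B12TreeDecay.kappa₀ (4 * 2 ^ 4) (2 * 4) ≤ κ) {δ₀ : ℝ} (hδ₀ : 0 < δ₀) :
    (∀ n, B12Decay510.GeomLeaf ((recordResponse9DataFromCtr F θ a Mc k (recordK₀ F Mc k)).G n) ((recordResponse9DataFromCtr F θ a Mc k (recordK₀ F Mc k)).ρ n) Mg 2 ∧
        B12Decay510.CubeSumLeaf ((recordResponse9DataFromCtr F θ a Mc k (recordK₀ F Mc k)).G n) (δ₀ / 2) ((2 * (1 - Real.exp (-(δ₀ / 2)))⁻¹) ^ 4) ∧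
        B12Decay510.TreeLeaf ((recordResponse9DataFromCtr F θ a Mc k (recordK₀ F Mc k)).Cc n) (κ / 2) (B12TreeDecay.K₀ (4 * 2 ^ 4) (2 * 4))) ∧
    ∀ (μ ν : Fin 4) (z : Fin 4 → ℤ), ∀ᶠ n in Filter.atTop,
      (recordResponse9DataFromCtr F θ a Mc k (recordK₀ F Mc k)).ρ n ((recordResponse9DataFromCtr F θ a Mc k (recordK₀ F Mc k)).e n μ 0)
        ((recordResponse9DataFromCtr F θ a Mc k (recordK₀ F Mc k)).e n ν z) = B12Sec2to5.l1 z :=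
  rowG_slot8_at_names hMc hMg hκ hδ₀

variable {F} in
/-- ★ The same row read through the UNSHIFTED-layer edition `recordResponse9DataFrom F θ a Mc k (recordK₀ F Mc k)`. [cite: Balaban1987RG1, (1.21) p.264, (4.37) p.290] -/
theorem rowG_slot8_at_from (θ : Stage13Params F 2) (a : θ.ιβ) {Mc k : ℕ} (hMc : McGuard F Mc) {Mg : ℝ} (hMg : 4 * (Mc : ℝ) ≤ Mg) {κ : ℝ}
    (hκ : 2 * B12TreeDecay.kappa₀ (4 * 2 ^ 4) (2 * 4) ≤ κ) {δ₀ : ℝ} (hδ₀ : 0 < δ₀) :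
    (∀ n, B12Decay510.GeomLeaf ((recordResponse9DataFrom F θ a Mc k (recordK₀ F Mc k)).G n) ((recordResponse9DataFrom F θ a Mc k (recordK₀ F Mc k)).ρ n) Mg 2 ∧
        B12Decay510.CubeSumLeaf ((recordResponse9DataFrom F θ a Mc k (recordK₀ F Mc k)).G n) (δ₀ / 2) ((2 * (1 - Real.exp (-(δ₀ / 2)))⁻¹) ^ 4) ∧
        B12Decay510.TreeLeaf ((recordResponse9DataFrom F θ a Mc k (recordK₀ F Mc k)).Cc n) (κ / 2) (B12TreeDecay.K₀ (4 * 2 ^ 4) (2 * 4))) ∧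
    ∀ (μ ν : Fin 4) (z : Fin 4 → ℤ), ∀ᶠ n in Filter.atTop,
      (recordResponse9DataFrom F θ a Mc k (recordK₀ F Mc k)).ρ n ((recordResponse9DataFrom F θ a Mc k (recordK₀ F Mc k)).e n μ 0)
        ((recordResponse9DataFrom F θ a Mc k (recordK₀ F Mc k)).e n ν z) = B12Sec2to5.l1 z :=
  rowG_slot8_at_names hMc hMg hκ hδ₀


end Summit.QuantumFields.YangMills.Theorems.PortHRecordRowG

end
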